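import Summits.RiemannHypothesis.RiemannHypothesis.Theorems.WeilGroundStateGroundStatesConvergeToXiRealNormalForm
import HarnessLib

/-!
# `WeilGroundState.GroundStatesConvergeToXi` — the tightness clause is a POSITIVITY-DEFECT condition
(crux item stmt-RiemannHypothesis-1527, route route-RiemannHypothesis-WeilGroundState; line `Sketch`,
rev L8, continuation lead c6; `--supports`; RH-free)

The open stub of the line (`A_real`: along some `a_k → ∞`, REAL EVEN ground states `u_k` and
`c_k > 0` with (T) tightness of `c_k u_k` in every `L¹(e^{b|t|})`, `b < 1/2`, and (M) convergence
of all moments) has exactly one clause that is not known to be NECESSARY for the crux: (T)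
(every other clause is a proved consequence of the crux, rev L7/L8).  This file identifies (T):

* `integral_norm_mul_exp_le_negPart` — **signed Laplace bound.**  For a ground state `u`, a
  scalar `c` with `c u` a.e. REAL, and `b ≥ 0`:
  `∫ ‖c u‖ e^{b|t|} ≤ ‖F(½+b)‖ + ‖F(½−b)‖ + ‖F(½)‖ + 4 ∫ (c u)⁻ e^{b|t|}`,
  `F = c · weilMellin u`, `(c u)⁻ = max(−Re(c u), 0)` the NEGATIVE PART (pointwise
  `|x| e^{b|t|} ≤ x e^{bt} + x e^{-bt} + x + 4x⁻ e^{b|t|}` for real `x`).  For `c u ≥ 0` this is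
  lead c1's `integral_norm_mul_exp_le_of_nonneg` (nonneg ⇒ tight).
* `tight_iff_negPart_bounded` — **along a real crux-shaped witness, (T_b) holds iff the
  exponential mass of the NEGATIVE PARTS is bounded**, for every `0 ≤ b < 1/2` (the transforms at
  the real points `½, ½ ± b` of the strip are bounded along the witness by the crux's convergence).
* `tightMomentLimit_real_iff_negPart` — **the open stub in positivity-defect form:**
  `A_real ⟺ ∃ a_k → ∞, real even ground states u_k, c_k > 0, with c_k · weilMellin u_k → ξ`
  `locally uniformly on the open strip AND sup_k ∫ c_k (u_k)⁻ e^{b|t|} < ∞ for every 0 ≤ b < 1/2`.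
  So the RH-content of the line beyond the crux itself is carried ENTIRELY by the negative
  lobes of the ground states: a crux witness whose (real, even, positively renormalised) ground
  states have uniformly small negative parts in the weighted `L¹` sense proves `A_real`, hence RH
  (`riemannHypothesis_of_negPart_cruxWitness`).  This is where the route's Perron–Frobenius theme
  (positivity of the true ground state, crux #2's mechanism; numerics `cos∠(u_a, Φχ_a) → 1`)
  meets crux #3.

No new definitions (the negative part is written inline as `max (-(·).re) 0`); Mathlib + landed
tree material only; standard axioms.
-/

set_option linter.dupNamespace false

noncomputable section

open scoped Topology Real ComplexConjugate
open Filter Set MeasureTheory Complex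

namespace Summit.RiemannHypothesis.RiemannHypothesis.Theorems.GroundStatesConvergeToXi

open Literature.NumberTheory.LFunctions

/-! ### The signed Laplace bound -/

/-- Pointwise: for real `x`, `b ≥ 0` and real `t`,
`|x| e^{b|t|} ≤ x e^{bt} + x e^{-bt} + x + 4 max(-x, 0) e^{b|t|}`
(`x ≥ 0`: `e^{b|t|} ≤ e^{bt} + e^{-bt} + 1`; `x < 0`: `e^{bt} + e^{-bt} + 1 ≤ 3 e^{b|t|}`). [folklore] -/
theorem abs_mul_exp_le_negPart (x : ℝ) {b : ℝ} (hb : 0 ≤ b) (t : ℝ) :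
    |x| * Real.exp (b * |t|) ≤ x * Real.exp (b * t) + x * Real.exp (-b * t) + x +
      4 * max (-x) 0 * Real.exp (b * |t|) := by
  have h1 : Real.exp (b * t) ≤ Real.exp (b * |t|) :=
    Real.exp_le_exp.2 (mul_le_mul_of_nonneg_left (le_abs_self t) hb)
  have h2 : Real.exp (-b * t) ≤ Real.exp (b * |t|) := by
    refine Real.exp_le_exp.2 ?_
    have : -b * t = b * (-t) := by ring
    rw [this]
    exact mul_le_mul_of_nonneg_left (neg_le_abs t) hb
  have h3 : 1 ≤ Real.exp (b * |t|) := Real.one_le_exp (by positivity)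
  have h4 : Real.exp (b * |t|) ≤ Real.exp (b * t) + Real.exp (-b * t) := by
    rcases le_or_gt 0 t with h0 | h0
    · rw [abs_of_nonneg h0]
      linarith [Real.exp_pos (-b * t)]
    · rw [abs_of_neg h0]
      have : b * -t = -b * t := by ring
      rw [this]
      linarith [Real.exp_pos (b * t)]
  have hp1 := Real.exp_pos (b * t)
  have hp2 := Real.exp_pos (-b * t)
  rcases le_or_gt 0 x with hx | hx
  · rw [abs_of_nonneg hx, max_eq_right (by linarith : -x ≤ 0)]
    nlinarith
  · rw [abs_of_neg hx, max_eq_left (by linarith : (0 : ℝ) ≤ -x)]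
    nlinarith

/-- **Signed Laplace bound.**  For a ground state `u` at a window `a`, a scalar `c` with `c u`
a.e. REAL-valued, and `b ≥ 0`:
`∫ ‖c u‖ e^{b|t|} ≤ ‖c û(½+b)‖ + ‖c û(½−b)‖ + ‖c û(½)‖ + 4 ∫ max(−Re(c u), 0) e^{b|t|}`.
The last integral is the weighted mass of the NEGATIVE PART of `c u`; for `c u ≥ 0` it vanishes
and the bound is lead c1's `integral_norm_mul_exp_le_of_nonneg`. [folklore] -/
theorem integral_norm_mul_exp_le_negPart {a : ℝ} {u : ℝ → ℂ} (hu : IsWeilGroundState a u)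
    (c : ℂ) (hreal : ∀ᵐ t : ℝ, (c * u t).im = 0) {b : ℝ} (hb : 0 ≤ b) :
    ∫ t, ‖c * u t‖ * Real.exp (b * |t|) ≤
      ‖c * weilMellin u (1 / 2 + b)‖ + ‖c * weilMellin u (1 / 2 - b)‖ + ‖c * weilMellin u (1 / 2)‖ +
        4 * ∫ t, max (-(c * u t).re) 0 * Real.exp (b * |t|) := by
  -- the one-sided Laplace integrals `∫ c u e^{b' t} = c û(1/2 + b')`
  have hI : ∀ b' : ℝ, Integrable fun t : ℝ => c * u t * cexp ((b' : ℂ) * t) := fun b' =>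
    ((hu.integrable_mul_cexp b').const_mul c).congr (ae_of_all _ fun t => by ring)
  have hL : ∀ b' : ℝ, ∫ t : ℝ, c * u t * cexp ((b' : ℂ) * t) = c * weilMellin u (1 / 2 + b') := by
    intro b'
    rw [← weilMellin_const_mul, weilMellin]
    refine integral_congr_ae (ae_of_all _ fun t => ?_)
    have e : (1 / 2 + (b' : ℂ) - 1 / 2) * (t : ℂ) = (b' : ℂ) * t := by ring
    dsimp only
    rw [e, mul_assoc]
  have hIre : ∀ b' : ℝ, Integrable fun t : ℝ => (c * u t * cexp ((b' : ℂ) * t)).re := fun b' => by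
    simpa only [RCLike.re_to_complex] using (hI b').re
  have hLre : ∀ b' : ℝ, ∫ t : ℝ, (c * u t * cexp ((b' : ℂ) * t)).re =
      (∫ t : ℝ, c * u t * cexp ((b' : ℂ) * t)).re := fun b' => by
    simpa only [RCLike.re_to_complex] using integral_re (hI b')
  have re_mul : ∀ r β t : ℝ, ((r : ℂ) * cexp ((β : ℂ) * t)).re = r * Real.exp (β * t) := by
    intro r β t
    rw [show (β : ℂ) * (t : ℂ) = ((β * t : ℝ) : ℂ) by push_cast; rfl, ← Complex.ofReal_exp,
      ← Complex.ofReal_mul, Complex.ofReal_re]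
  -- the weighted negative part is integrable (dominated by `‖c u‖ e^{b|t|}`)
  have hW := stub_pointwise_of_weak_integrable_weight hu c b
  have hN : Integrable fun t : ℝ => max (-(c * u t).re) 0 * Real.exp (b * |t|) := by
    refine hW.mono' ?_ (ae_of_all _ fun t => ?_)
    · have hm : AEStronglyMeasurable (fun t : ℝ => (c * u t).re) volume :=
        Complex.continuous_re.comp_aestronglyMeasurable
          ((hu.integrable.aestronglyMeasurable).const_mul c)
      exact ((hm.neg.sup aestronglyMeasurable_const).mul
        (by fun_prop : Continuous fun t : ℝ => Real.exp (b * |t|)).aestronglyMeasurable)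
    · rw [Real.norm_of_nonneg (by positivity)]
      refine mul_le_mul_of_nonneg_right ?_ (Real.exp_pos _).le
      refine max_le ?_ (norm_nonneg _)
      exact (neg_le_abs _).trans (Complex.abs_re_le_norm _)
  -- pointwise signed bound, a.e.
  have hpt : ∀ᵐ t : ℝ, ‖c * u t‖ * Real.exp (b * |t|) ≤
      (c * u t * cexp ((b : ℂ) * t)).re + (c * u t * cexp (((-b : ℝ) : ℂ) * t)).re +
        (c * u t * cexp (((0 : ℝ) : ℂ) * t)).re +
        4 * (max (-(c * u t).re) 0 * Real.exp (b * |t|)) := by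
    filter_upwards [hreal] with t ht
    set x : ℝ := (c * u t).re with hx
    have hv : c * u t = (x : ℂ) := by
      apply Complex.ext <;> simp [hx, ht]
    have hnorm : ‖c * u t‖ = |x| := by
      rw [hv, Complex.norm_real, Real.norm_eq_abs]
    have e1 : (c * u t * cexp ((b : ℂ) * t)).re = x * Real.exp (b * t) := by
      rw [hv]; exact re_mul _ _ _
    have e2 : (c * u t * cexp (((-b : ℝ) : ℂ) * t)).re = x * Real.exp (-b * t) := by
      rw [hv]; exact re_mul _ _ _
    have e3 : (c * u t * cexp (((0 : ℝ) : ℂ) * t)).re = x := by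
      rw [hv, re_mul]
      simp
    rw [e1, e2, e3, hnorm]
    have h := abs_mul_exp_le_negPart x hb t
    linarith
  have hI0 := hIre 0
  have hAB : Integrable (fun t : ℝ => (c * u t * cexp ((b : ℂ) * t)).re +
      (c * u t * cexp (((-b : ℝ) : ℂ) * t)).re) := (hIre b).add (hIre (-b))
  have hABC : Integrable (fun t : ℝ => (c * u t * cexp ((b : ℂ) * t)).re +
      (c * u t * cexp (((-b : ℝ) : ℂ) * t)).re + (c * u t * cexp (((0 : ℝ) : ℂ) * t)).re) :=
    hAB.add hI0
  have hD : Integrable (fun t : ℝ => 4 * (max (-(c * u t).re) 0 * Real.exp (b * |t|))) :=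
    hN.const_mul 4
  calc ∫ t, ‖c * u t‖ * Real.exp (b * |t|)
      ≤ ∫ t, ((c * u t * cexp ((b : ℂ) * t)).re + (c * u t * cexp (((-b : ℝ) : ℂ) * t)).re +
          (c * u t * cexp (((0 : ℝ) : ℂ) * t)).re +
          4 * (max (-(c * u t).re) 0 * Real.exp (b * |t|))) :=
        integral_mono_ae hW (hABC.add hD) hpt
    _ = (∫ t, c * u t * cexp ((b : ℂ) * t)).re + (∫ t, c * u t * cexp (((-b : ℝ) : ℂ) * t)).re +
          (∫ t, c * u t * cexp (((0 : ℝ) : ℂ) * t)).re +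
          4 * ∫ t, max (-(c * u t).re) 0 * Real.exp (b * |t|) := by
        rw [integral_add hABC hD, integral_add hAB hI0, integral_add (hIre b) (hIre (-b)),
          hLre b, hLre (-b), hLre 0, integral_const_mul]
    _ = (c * weilMellin u (1 / 2 + b)).re + (c * weilMellin u (1 / 2 - b)).re +
          (c * weilMellin u (1 / 2)).re +
          4 * ∫ t, max (-(c * u t).re) 0 * Real.exp (b * |t|) := by
        rw [hL b, hL (-b), hL 0]
        push_cast
        ring_nf
    _ ≤ _ := by
        gcongr
        · exact Complex.re_le_norm _
        · exact Complex.re_le_norm _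
        · exact Complex.re_le_norm _

/-- The weighted mass of the negative part is at most the full weighted mass (trivial direction). [folklore] -/
theorem integral_negPart_mul_exp_le {a : ℝ} {u : ℝ → ℂ} (hu : IsWeilGroundState a u) (c : ℂ)
    (b : ℝ) :
    ∫ t, max (-(c * u t).re) 0 * Real.exp (b * |t|) ≤ ∫ t, ‖c * u t‖ * Real.exp (b * |t|) := by
  refine integral_mono_of_nonneg (ae_of_all _ fun t => by positivity)
    (stub_pointwise_of_weak_integrable_weight hu c b) (ae_of_all _ fun t => ?_)
  refine mul_le_mul_of_nonneg_right (max_le ?_ (norm_nonneg _)) (Real.exp_pos _).le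
  exact (neg_le_abs _).trans (Complex.abs_re_le_norm _)

/-! ### Along a crux witness the transforms at real points are bounded -/

/-- Along a crux-shaped witness, `‖c_k û_k(σ)‖` is bounded in `k` at every real point `σ` of the
open strip (pointwise convergence to `ξ(σ)`; convergent real sequences are bounded). [folklore] -/
theorem exists_norm_renorm_weilMellin_le_of_cruxWitness {u : ℕ → ℝ → ℂ} {c : ℕ → ℂ}
    (hlim : TendstoLocallyUniformlyOn (fun k s => c k * weilMellin (u k) s) riemannXi atTop
      {s : ℂ | 0 < s.re ∧ s.re < 1}) {σ : ℝ} (hσ : σ ∈ Ioo (0 : ℝ) 1) :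
    ∃ B : ℝ, ∀ k, ‖c k * weilMellin (u k) σ‖ ≤ B := by
  have ht := ((hlim.tendsto_at (ofReal_mem_strip hσ)).norm).bddAbove_range
  obtain ⟨B, hB⟩ := ht
  exact ⟨B, fun k => hB ⟨k, rfl⟩⟩

/-! ### (T) ⟺ bounded negative parts -/

/-- **Along a real crux-shaped witness, tightness at an exponent `0 ≤ b < 1/2` holds iff the
weighted mass of the NEGATIVE PARTS is bounded.**  Hypotheses: ground states `u_k`, scalars
`c_k` with `c_k u_k` a.e. real, and `c_k · weilMellin u_k → ξ` locally uniformly on the open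
strip (only boundedness at the three real points `½`, `½ ± b` is used). [folklore] -/
theorem tight_iff_negPart_bounded {a : ℕ → ℝ} {u : ℕ → ℝ → ℂ} {c : ℕ → ℂ}
    (hu : ∀ k, IsWeilGroundState (a k) (u k)) (hreal : ∀ k, ∀ᵐ t : ℝ, (c k * u k t).im = 0)
    (hlim : TendstoLocallyUniformlyOn (fun k s => c k * weilMellin (u k) s) riemannXi atTop
      {s : ℂ | 0 < s.re ∧ s.re < 1}) {b : ℝ} (hb0 : 0 ≤ b) (hb : b < 1 / 2) :
    (∃ M : ℝ, ∀ k, ∫ t, ‖c k * u k t‖ * Real.exp (b * |t|) ≤ M) ↔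
      ∃ M : ℝ, ∀ k, ∫ t, max (-(c k * u k t).re) 0 * Real.exp (b * |t|) ≤ M := by
  constructor
  · rintro ⟨M, hM⟩
    exact ⟨M, fun k => (integral_negPart_mul_exp_le (hu k) (c k) b).trans (hM k)⟩
  · rintro ⟨M, hM⟩
    obtain ⟨B₁, hB₁⟩ := exists_norm_renorm_weilMellin_le_of_cruxWitness hlim (σ := 1 / 2 + b)
      ⟨by linarith, by linarith⟩
    obtain ⟨B₂, hB₂⟩ := exists_norm_renorm_weilMellin_le_of_cruxWitness hlim (σ := 1 / 2 - b)
      ⟨by linarith, by linarith⟩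
    obtain ⟨B₀, hB₀⟩ := exists_norm_renorm_weilMellin_le_of_cruxWitness hlim (σ := 1 / 2)
      ⟨by norm_num, by norm_num⟩
    refine ⟨B₁ + B₂ + B₀ + 4 * M, fun k => ?_⟩
    have h := integral_norm_mul_exp_le_negPart (hu k) (c k) (hreal k) hb0
    have e1 : ((1 / 2 + b : ℝ) : ℂ) = 1 / 2 + (b : ℂ) := by push_cast; ring
    have e2 : ((1 / 2 - b : ℝ) : ℂ) = 1 / 2 - (b : ℂ) := by push_cast; ring
    have e0 : ((1 / 2 : ℝ) : ℂ) = 1 / 2 := by push_cast; ring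
    have h1 := hB₁ k; have h2 := hB₂ k; have h0 := hB₀ k
    rw [e1] at h1; rw [e2] at h2; rw [e0] at h0
    have h4 := hM k
    linarith

/-- **The full tightness clause (T) ⟺ bounded negative parts at every `0 ≤ b < 1/2`** (exponents
`b < 0` follow from `b = 0` by monotonicity, `tight_mono`). [folklore] -/
theorem tight_all_iff_negPart_bounded {a : ℕ → ℝ} {u : ℕ → ℝ → ℂ} {c : ℕ → ℂ}
    (hu : ∀ k, IsWeilGroundState (a k) (u k)) (hreal : ∀ k, ∀ᵐ t : ℝ, (c k * u k t).im = 0)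
    (hlim : TendstoLocallyUniformlyOn (fun k s => c k * weilMellin (u k) s) riemannXi atTop
      {s : ℂ | 0 < s.re ∧ s.re < 1}) :
    (∀ b : ℝ, b < 1 / 2 → ∃ M : ℝ, ∀ k, ∫ t, ‖c k * u k t‖ * Real.exp (b * |t|) ≤ M) ↔
      ∀ b : ℝ, 0 ≤ b → b < 1 / 2 →
        ∃ M : ℝ, ∀ k, ∫ t, max (-(c k * u k t).re) 0 * Real.exp (b * |t|) ≤ M := by
  constructor
  · intro h b hb0 hb
    exact (tight_iff_negPart_bounded hu hreal hlim hb0 hb).1 (h b hb)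
  · intro h b hb
    set b' : ℝ := max b 0 with hb'
    have hb'0 : 0 ≤ b' := le_max_right _ _
    have hb'1 : b' < 1 / 2 := max_lt hb (by norm_num)
    obtain ⟨M, hM⟩ := (tight_iff_negPart_bounded hu hreal hlim hb'0 hb'1).2 (h b' hb'0 hb'1)
    exact ⟨M, fun k => tight_mono hu (le_max_left b 0) hM k⟩

/-! ### The open stub in positivity-defect form -/

/-- For a real-valued `u` and a real scalar `c`, `c u` is (everywhere, hence a.e.) real. [folklore] -/
theorem im_ofReal_mul_eq_zero {u : ℝ → ℂ} (hre : ∀ t, (u t).im = 0) (c : ℝ) (t : ℝ) :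
    ((c : ℂ) * u t).im = 0 := by
  simp [Complex.mul_im, hre t]

/-- **The open stub `A_real` in positivity-defect form (RH-free).**  `A_real` (∃ `a_k → ∞`, real
even ground states `u_k`, `c_k > 0`, (T) tightness, (M) moments) holds iff there is a
crux-shaped witness with REAL EVEN ground states and POSITIVE constants whose NEGATIVE PARTS have
bounded weighted mass, `sup_k ∫ c_k max(−Re u_k, 0) e^{b|t|} < ∞` for every `0 ≤ b < 1/2`.
(⇒) transfer to the convergence clause and `(c u)⁻ ≤ |c u|`; (⇐) `tight_all_iff_negPart_bounded`
and `stub_moments_of_strip`.  So beyond the crux itself, the RH-content of the line's open stub is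
carried entirely by the negative lobes of the ground states. [folklore] -/
theorem tightMomentLimit_real_iff_negPart :
    (∃ a : ℕ → ℝ, ∃ u : ℕ → ℝ → ℂ, ∃ c : ℕ → ℝ, Tendsto a atTop atTop ∧ (∀ k, 0 < c k) ∧
      (∀ k, IsWeilGroundState (a k) (u k)) ∧ (∀ k t, u k (-t) = u k t) ∧
      (∀ k t, (u k t).im = 0) ∧
      (∀ b : ℝ, b < 1 / 2 → ∃ M : ℝ, ∀ k, ∫ t, ‖(c k : ℂ) * u k t‖ * Real.exp (b * |t|) ≤ M) ∧
      (∀ n : ℕ, Tendsto (fun k => (c k : ℂ) * ∫ t, u k t * (t : ℂ) ^ n) atTop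
        (𝓝 (∫ t, 2 * LagariasMontague.Psic (2 * t) * (t : ℂ) ^ n)))) ↔
    (∃ a : ℕ → ℝ, ∃ u : ℕ → ℝ → ℂ, ∃ c : ℕ → ℝ, Tendsto a atTop atTop ∧ (∀ k, 0 < c k) ∧
      (∀ k, IsWeilGroundState (a k) (u k)) ∧ (∀ k t, u k (-t) = u k t) ∧
      (∀ k t, (u k t).im = 0) ∧
      (∀ b : ℝ, 0 ≤ b → b < 1 / 2 →
        ∃ M : ℝ, ∀ k, ∫ t, max (-((c k : ℂ) * u k t).re) 0 * Real.exp (b * |t|) ≤ M) ∧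
      TendstoLocallyUniformlyOn (fun k s => (c k : ℂ) * weilMellin (u k) s) riemannXi atTop
        {s : ℂ | 0 < s.re ∧ s.re < 1}) := by
  constructor
  · rintro ⟨a, u, c, ha, hc, hu, hev, hre, htight, hmom⟩
    have hlim := stub_locallyUniform_of_pointwise hu htight
      (stub_pointwise_of_tight_moments hu htight hmom)
    refine ⟨a, u, c, ha, hc, hu, hev, hre, fun b hb0 hb => ?_, hlim⟩
    obtain ⟨M, hM⟩ := htight b hb
    exact ⟨M, fun k => (integral_negPart_mul_exp_le (hu k) (c k) b).trans (hM k)⟩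
  · rintro ⟨a, u, c, ha, hc, hu, hev, hre, hneg, hlim⟩
    have hreal : ∀ k, ∀ᵐ t : ℝ, ((c k : ℂ) * u k t).im = 0 := fun k =>
      ae_of_all _ fun t => im_ofReal_mul_eq_zero (hre k) (c k) t
    have htight := (tight_all_iff_negPart_bounded hu hreal hlim).2 hneg
    exact ⟨a, u, c, ha, hc, hu, hev, hre, htight, stub_moments_of_strip hu hlim⟩

/-- **A crux witness with uniformly small negative lobes proves RH (RH-free criterion).**  If
along some `a_k → ∞` there are real even ground states `u_k` and `c_k > 0` with
`c_k · weilMellin u_k → ξ` locally uniformly on the open strip and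
`sup_k ∫ c_k max(−Re u_k, 0) e^{b|t|} < ∞` for every `0 ≤ b < 1/2`, then the Riemann Hypothesis
holds (`tightMomentLimit_real_iff_negPart` and `riemannHypothesis_of_tightMomentLimit_real`).
The non-negative case (`u_k ≥ 0`) is lead c1's `riemannHypothesis_of_nonneg_cruxWitness`. [folklore] -/
theorem riemannHypothesis_of_negPart_cruxWitness
    (h : ∃ a : ℕ → ℝ, ∃ u : ℕ → ℝ → ℂ, ∃ c : ℕ → ℝ, Tendsto a atTop atTop ∧ (∀ k, 0 < c k) ∧
      (∀ k, IsWeilGroundState (a k) (u k)) ∧ (∀ k t, u k (-t) = u k t) ∧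
      (∀ k t, (u k t).im = 0) ∧
      (∀ b : ℝ, 0 ≤ b → b < 1 / 2 →
        ∃ M : ℝ, ∀ k, ∫ t, max (-((c k : ℂ) * u k t).re) 0 * Real.exp (b * |t|) ≤ M) ∧
      TendstoLocallyUniformlyOn (fun k s => (c k : ℂ) * weilMellin (u k) s) riemannXi atTop
        {s : ℂ | 0 < s.re ∧ s.re < 1}) :
    RiemannHypothesis :=
  riemannHypothesis_of_tightMomentLimit_real (tightMomentLimit_real_iff_negPart.2 h)

end Summit.RiemannHypothesis.RiemannHypothesis.Theorems.GroundStatesConvergeToXi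

end
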